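import Mathlib
import Literature.NumberTheory.LFunctions.Zhang2022.Section4Contour49Pointwise
import HarnessLib

/-!
# Zhang (2022) §4, (4.9): `Section4.Contour49Bound` and `Section4.Ded49` HOLD

Topic `Literature/NumberTheory/LFunctions/Zhang2022` (Landau–Siegel audit tree; verdict-neutral;
D-0069 campaign node **Z22:(4.9)** (shifted-contour bound) / **Z22:§4.u036–u037**, locator
[Z22 pp.20–21, proof of Lemma 4.4, tex L1117–L1125]). Y. Zhang, *Discrete mean estimates and the
Landau–Siegel zero*, arXiv:2211.02515v1 (2022) [Zhang2022LandauSiegel] — **an unrefereed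
manuscript under adjudication**:

> The estimate (4.9) follows by moving the contour of integration […] and applying (4.5) and
> trivial bounds for `ω₁(w)` and the involved sum.

`contour49Bound_holds : Section4.Contour49Bound` with `c = 1`: the five pieces of
`Section4.perronContour D (f49 χ x s) (−σ−1/2) (−σ−10) 𝓛²⁰` are bounded by the pointwise estimates
of `Section4Contour49Pointwise` (middle segment `≪ e^{−14𝓛⁹}·𝓛²⁰`, horizontals `≪ e^{−1.9𝓛⁹}`,
tails `≪ D P² e^{−𝓛¹⁰/8}·poly(𝓛)` via the Gaussian tail `integral_Ioi_sq_mul_gauss_le`), for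
`𝓛 ≥ 100`, every `ψ ∈ Ψ`, every real primitive `χ`; hence `≤ C·P⁻¹`. `ded49_holds : Ded49` is the
typed deduction (its hypothesis `Eq45` is not needed — see the module docstring of
`Section4Contour49Pointwise` for why (4.5) as printed would not suffice anyway). UNCONDITIONAL; no
definition, no named fact. WHAT THIS IS NOT: any statement about Theorems 1–2 of the manuscript or
about Landau–Siegel zeros.

## References

* Y. Zhang, arXiv:2211.02515v1 (2022), §4 pp.19–21, (4.9). [cite: Zhang2022LandauSiegel, §4 (4.9)]
-/

noncomputable section

open Complex Real Set MeasureTheory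

open scoped Interval

namespace Literature.NumberTheory.LFunctions.Zhang2022.Section4

open Skeleton

/-- `L^k ≤ e^{kL}` for `L ≥ 1`. [folklore] -/
private lemma pow_le_exp_mul' {L : ℝ} (hL : 1 ≤ L) (k : ℕ) : L ^ k ≤ Real.exp (k * L) := by
  have h1 : L ≤ Real.exp L := by have := Real.add_one_le_exp L; linarith
  calc L ^ k ≤ (Real.exp L) ^ k := pow_le_pow_left₀ (by linarith) h1 k
    _ = Real.exp (k * L) := by rw [← Real.exp_nat_mul]

/-- `kL ≤ L⁹/10` for `L ≥ 100`, `k ≤ 10⁶`. [folklore] -/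
private lemma mul_le_pow9' {L : ℝ} (hL : 100 ≤ L) {k : ℝ} (hk : k ≤ 1000000) :
    k * L ≤ L ^ 9 / 10 := by
  have hL8 : (100 : ℝ) ^ 8 ≤ L ^ 8 := pow_le_pow_left₀ (by norm_num) hL 8
  have e : L ^ 9 = L ^ 8 * L := by ring
  rw [e]
  nlinarith

/-- The Gaussian-moment integrand `(A + v²)e^{−v²/(4Λ)}` is integrable (`Λ > 0`). [folklore] -/
private lemma integrable_sq_weight_gauss {Λ : ℝ} (hΛ : 0 < Λ) (A : ℝ) :
    Integrable fun v : ℝ => (A + v ^ 2) * Real.exp (-(v ^ 2) / (4 * Λ)) := by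
  have hb4 : 0 < 1 / (4 * Λ) := by positivity
  have hf1 : Integrable fun v : ℝ => Real.exp (-(1 / (4 * Λ)) * v ^ 2) := integrable_exp_neg_mul_sq hb4
  have hf2 : Integrable fun v : ℝ => v ^ 2 * Real.exp (-(1 / (4 * Λ)) * v ^ 2) := by
    have := integrable_rpow_mul_exp_neg_mul_sq hb4 (show (-1 : ℝ) < 2 by norm_num)
    simpa [Real.rpow_two] using this
  have := (hf1.const_mul A).add hf2
  refine this.congr (ae_of_all _ fun v => ?_)
  simp only [Pi.add_apply]
  have e : -(1 / (4 * Λ)) * v ^ 2 = -(v ^ 2) / (4 * Λ) := by field_simp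
  rw [e]; ring

/-- The tail budget: for `𝓛 ≥ 100` and `|t| ≤ 9𝓛⁵¹⁹`,
`D·P²·(e^{−𝓛¹⁰/8}·((3/2+|t|)² + 16𝓛³⁰)·√(16π𝓛³⁰)) ≤ e^{−10𝓛⁹}`.
[cite: Zhang2022LandauSiegel, §4 (4.9) (proof)] -/
private lemma tail_budget {D : ℕ} (hD : 3 ≤ D) (hL : 100 ≤ ell D) {t : ℝ}
    (ht : |t| ≤ 9 * ell D ^ 519) :
    (D : ℝ) * bigP D ^ 2 * (Real.exp (-((ell D ^ 20) ^ 2) / (8 * ell D ^ 30)) *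
        ((3 / 2 + |t|) ^ 2 + 16 * ell D ^ 30) * Real.sqrt (16 * π * ell D ^ 30))
      ≤ Real.exp (-10 * ell D ^ 9) := by
  have hL1 : 1 ≤ ell D := by linarith
  have hL0 : 0 < ell D := by linarith
  have hDexp : (D : ℝ) = Real.exp (ell D) := by
    rw [ell, Real.exp_log]; exact_mod_cast (show 0 < D by omega)
  have hP2 : bigP D ^ 2 = Real.exp (2 * ell D ^ 9) := by
    rw [bigP, ← Real.exp_nat_mul]; norm_num
  have hV : Real.exp (-((ell D ^ 20) ^ 2) / (8 * ell D ^ 30)) = Real.exp (-(ell D ^ 10 / 8)) := by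
    congr 1
    have h30 : ell D ^ 30 ≠ 0 := by positivity
    field_simp
  -- polynomial factors
  have h519 : (3 : ℝ) ≤ ell D ^ 519 := le_trans (by linarith) (le_self_pow₀ hL1 (by norm_num))
  have hA : (3 / 2 + |t|) ^ 2 + 16 * ell D ^ 30 ≤ 116 * ell D ^ 1038 := by
    have h1 : 3 / 2 + |t| ≤ 10 * ell D ^ 519 := by linarith
    have h2 : (3 / 2 + |t|) ^ 2 ≤ (10 * ell D ^ 519) ^ 2 := pow_le_pow_left₀ (by positivity) h1 2
    have h3 : ell D ^ 30 ≤ ell D ^ 1038 := pow_le_pow_right₀ hL1 (by norm_num)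
    have e : (10 * ell D ^ 519) ^ 2 = 100 * ell D ^ 1038 := by ring
    linarith
  have hS : Real.sqrt (16 * π * ell D ^ 30) ≤ 8 * ell D ^ 15 := by
    rw [Real.sqrt_le_left (by positivity)]
    have : (8 * ell D ^ 15) ^ 2 = 64 * ell D ^ 30 := by ring
    rw [this]; nlinarith [Real.pi_lt_four, pow_nonneg hL0.le 30]
  have hpoly : (116 * ell D ^ 1038) * (8 * ell D ^ 15) ≤ Real.exp (0.2 * ell D ^ 9) := by
    have h1 : ell D ^ 1053 ≤ Real.exp (1053 * ell D) := pow_le_exp_mul' hL1 1053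
    have h928 : (928 : ℝ) ≤ Real.exp 7 := by
      have h27 : (2.7 : ℝ) ^ 7 ≤ Real.exp 7 := by
        calc (2.7 : ℝ) ^ 7 ≤ (Real.exp 1) ^ 7 :=
              pow_le_pow_left₀ (by norm_num) (by linarith [Real.exp_one_gt_d9]) 7
          _ = Real.exp 7 := by rw [← Real.exp_nat_mul]; norm_num
      have : (928 : ℝ) ≤ (2.7 : ℝ) ^ 7 := by norm_num
      linarith
    have hlin : (7 : ℝ) + 1053 * ell D ≤ 0.2 * ell D ^ 9 := by
      have := mul_le_pow9' hL (k := 10600) (by norm_num)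
      linarith
    calc (116 * ell D ^ 1038) * (8 * ell D ^ 15) = 928 * ell D ^ 1053 := by ring
      _ ≤ Real.exp 7 * Real.exp (1053 * ell D) :=
          mul_le_mul h928 h1 (by positivity) (by positivity)
      _ = Real.exp (7 + 1053 * ell D) := by rw [← Real.exp_add]
      _ ≤ Real.exp (0.2 * ell D ^ 9) := Real.exp_le_exp.mpr hlin
  have h10 : ell D ^ 10 / 8 ≥ 12.5 * ell D ^ 9 := by
    have e : ell D ^ 10 = ell D ^ 9 * ell D := by ring
    rw [e]; nlinarith [pow_nonneg hL0.le 9]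
  have hLlin : ell D ≤ 0.1 * ell D ^ 9 := by
    have := mul_le_pow9' hL (k := 1) (by norm_num); linarith
  rw [hDexp, hP2, hV]
  have hfac : ((3 / 2 + |t|) ^ 2 + 16 * ell D ^ 30) * Real.sqrt (16 * π * ell D ^ 30)
      ≤ Real.exp (0.2 * ell D ^ 9) :=
    le_trans (mul_le_mul hA hS (by positivity) (by positivity)) hpoly
  calc Real.exp (ell D) * Real.exp (2 * ell D ^ 9) * (Real.exp (-(ell D ^ 10 / 8)) *
          ((3 / 2 + |t|) ^ 2 + 16 * ell D ^ 30) * Real.sqrt (16 * π * ell D ^ 30))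
      = Real.exp (ell D) * Real.exp (2 * ell D ^ 9) * Real.exp (-(ell D ^ 10 / 8)) *
          (((3 / 2 + |t|) ^ 2 + 16 * ell D ^ 30) * Real.sqrt (16 * π * ell D ^ 30)) := by ring
    _ ≤ Real.exp (ell D) * Real.exp (2 * ell D ^ 9) * Real.exp (-(ell D ^ 10 / 8)) *
          Real.exp (0.2 * ell D ^ 9) := by gcongr
    _ = Real.exp (ell D + 2 * ell D ^ 9 - ell D ^ 10 / 8 + 0.2 * ell D ^ 9) := by
        rw [← Real.exp_add, ← Real.exp_add, ← Real.exp_add]; ring_nf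
    _ ≤ Real.exp (-10 * ell D ^ 9) := Real.exp_le_exp.mpr (by linarith)

section Pieces

variable {D : ℕ} [NeZero D] (χ : DirichletCharacter ℂ D) (x : Chr D)

/-- **Middle segment of the (4.9)-contour**: for `𝓛 ≥ 100`, `s ∈ Ω₃`,
`‖∫_{−𝓛²⁰}^{𝓛²⁰} (integrand)(−σ−10+iv) dv‖ ≤ 2C_τS e^{36}·e^{−𝓛⁹}` (pointwise `e^{−14𝓛⁹}` times the
length `2𝓛²⁰ ≤ e^{13𝓛⁹}`). [cite: Zhang2022LandauSiegel, §4 (4.9) (proof)] -/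
theorem norm_middle49_le (hD : 3 ≤ D) (hχ : χ.IsPrimitive) (hL : 100 ≤ ell D)
    {C : ℝ} (hC1 : 1 ≤ C) (hC : ∀ n : ℕ, n ≠ 0 → ((n.divisors.card : ℕ) : ℝ) ≤ C * (n : ℝ) ^ (1 / 4 : ℝ))
    {s : ℂ} (hs : s ∈ Omega3 D) (hα : alpha D ≤ 1 / 4) :
    ‖∫ v in (-(ell D ^ 20))..(ell D ^ 20),
        perronIntegrand D (f49 χ x s) (((-s.re - 10 : ℝ) : ℂ) + v * I)‖
      ≤ 2 * C * (∑' n : ℕ, (n : ℝ) ^ (-(5 / 4 : ℝ))) * Real.exp 36 * Real.exp (-(ell D ^ 9)) := by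
  have hL1 : 1 ≤ ell D := by linarith
  set S : ℝ := ∑' n : ℕ, (n : ℝ) ^ (-(5 / 4 : ℝ)) with hSdef
  have hS0 : 0 ≤ S := tsum_nonneg fun n => by positivity
  set V : ℝ := ell D ^ 20 with hV_def
  have hV0 : 0 ≤ V := by positivity
  have hM : ‖∫ v in (-V)..V, perronIntegrand D (f49 χ x s) (((-s.re - 10 : ℝ) : ℂ) + v * I)‖
      ≤ (2 * C * S * Real.exp 36 * Real.exp (-14 * ell D ^ 9)) * |V - (-V)| := by
    refine intervalIntegral.norm_integral_le_of_norm_le_const fun v hv => ?_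
    have hv' : |v| ≤ ell D ^ 20 := by
      rw [Set.uIoc_of_le (by linarith)] at hv
      exact abs_le.mpr ⟨le_of_lt hv.1, hv.2⟩
    exact norm_f49_integrand_middle_le χ x hD hχ hL hC1 hC hs hα hv'
  have hVV : |V - (-V)| = 2 * V := by rw [sub_neg_eq_add, abs_of_nonneg (by linarith)]; ring
  have hVexp : 2 * V ≤ Real.exp (13 * ell D ^ 9) := by
    have h1 : V ≤ Real.exp (20 * ell D) := by
      have := pow_le_exp_mul' hL1 20
      rw [hV_def]; exact_mod_cast this
    have h2 : Real.exp (20 * ell D) ≤ Real.exp (ell D ^ 9 / 10) :=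
      Real.exp_le_exp.mpr (mul_le_pow9' hL (by norm_num))
    have h100 : (100 : ℝ) ≤ ell D ^ 9 := le_trans hL (le_self_pow₀ hL1 (by norm_num))
    have h3 : (2 : ℝ) ≤ Real.exp (ell D ^ 9 / 10) :=
      le_trans (by linarith [Real.exp_one_gt_d9]) (Real.exp_le_exp.mpr (by linarith : (1 : ℝ) ≤ ell D ^ 9 / 10))
    calc 2 * V ≤ Real.exp (ell D ^ 9 / 10) * Real.exp (ell D ^ 9 / 10) :=
          mul_le_mul h3 (h1.trans h2) hV0 (by positivity)
      _ = Real.exp (ell D ^ 9 / 5) := by rw [← Real.exp_add]; ring_nf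
      _ ≤ Real.exp (13 * ell D ^ 9) := Real.exp_le_exp.mpr (by linarith)
  rw [hVV] at hM
  refine hM.trans ?_
  have key : Real.exp (-14 * ell D ^ 9) * (2 * V) ≤ Real.exp (-(ell D ^ 9)) := by
    calc Real.exp (-14 * ell D ^ 9) * (2 * V) ≤ Real.exp (-14 * ell D ^ 9) * Real.exp (13 * ell D ^ 9) :=
          mul_le_mul_of_nonneg_left hVexp (by positivity)
      _ = Real.exp (-(ell D ^ 9)) := by rw [← Real.exp_add]; ring_nf
  calc 2 * C * S * Real.exp 36 * Real.exp (-14 * ell D ^ 9) * (2 * V)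
      = 2 * C * S * Real.exp 36 * (Real.exp (-14 * ell D ^ 9) * (2 * V)) := by ring
    _ ≤ 2 * C * S * Real.exp 36 * Real.exp (-(ell D ^ 9)) :=
        mul_le_mul_of_nonneg_left key (by positivity)

/-- **Horizontal segments of the (4.9)-contour** (`W = ±𝓛²⁰`): for `𝓛 ≥ 100`, `s ∈ Ω₃`,
`‖∫_{−σ−1/2}^{−σ−10} (integrand)(u+iW) du‖ ≤ 19C_τS e^{36}·e^{−𝓛⁹}` (pointwise `e^{−1.9𝓛⁹}`, length
`19/2`). [cite: Zhang2022LandauSiegel, §4 (4.9) (proof)] -/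
theorem norm_horiz49_le (hD : 3 ≤ D) (hχ : χ.IsPrimitive) (hL : 100 ≤ ell D)
    {C : ℝ} (hC1 : 1 ≤ C) (hC : ∀ n : ℕ, n ≠ 0 → ((n.divisors.card : ℕ) : ℝ) ≤ C * (n : ℝ) ^ (1 / 4 : ℝ))
    {s : ℂ} (hs : s ∈ Omega3 D) (hα : alpha D ≤ 1 / 4) {W : ℝ}
    (hW : W = ell D ^ 20 ∨ W = -(ell D ^ 20)) :
    ‖∫ u in (-s.re - 1 / 2)..(-s.re - 10), perronIntegrand D (f49 χ x s) ((u : ℂ) + W * I)‖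
      ≤ 19 * C * (∑' n : ℕ, (n : ℝ) ^ (-(5 / 4 : ℝ))) * Real.exp 36 * Real.exp (-(ell D ^ 9)) := by
  set S : ℝ := ∑' n : ℕ, (n : ℝ) ^ (-(5 / 4 : ℝ)) with hSdef
  have hS0 : 0 ≤ S := tsum_nonneg fun n => by positivity
  have hH : ‖∫ u in (-s.re - 1 / 2)..(-s.re - 10), perronIntegrand D (f49 χ x s) ((u : ℂ) + W * I)‖
      ≤ (2 * C * S * Real.exp 36 * Real.exp (-1.9 * ell D ^ 9)) * |(-s.re - 10) - (-s.re - 1 / 2)| := by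
    refine intervalIntegral.norm_integral_le_of_norm_le_const fun u hu => ?_
    rw [Set.uIoc_of_ge (by linarith)] at hu
    exact norm_f49_integrand_horiz_le χ x hD hχ hL hC1 hC hs hα (le_of_lt hu.1) hu.2 hW
  have hba : |(-s.re - 10) - (-s.re - 1 / 2)| = 19 / 2 := by
    rw [abs_of_nonpos (by linarith)]; ring
  rw [hba] at hH
  refine hH.trans ?_
  have h9 : 0 ≤ ell D ^ 9 := by positivity
  have hE : Real.exp (-1.9 * ell D ^ 9) ≤ Real.exp (-(ell D ^ 9)) := Real.exp_le_exp.mpr (by linarith)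
  calc 2 * C * S * Real.exp 36 * Real.exp (-1.9 * ell D ^ 9) * (19 / 2)
      = 19 * C * S * Real.exp 36 * Real.exp (-1.9 * ell D ^ 9) := by ring
    _ ≤ 19 * C * S * Real.exp 36 * Real.exp (-(ell D ^ 9)) :=
        mul_le_mul_of_nonneg_left hE (by positivity)

/-- **Upper tail of the (4.9)-contour**: for `𝓛 ≥ 100`, `s ∈ Ω₃`,
`‖∫_{v>𝓛²⁰} (integrand)(−σ−1/2+iv) dv‖ ≤ 8e·C_τS·e^{−𝓛⁹}` (Gaussian tail `e^{−𝓛¹⁰/8}` against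
`D P²·poly(𝓛)`). [cite: Zhang2022LandauSiegel, §4 (4.9) (proof)] -/
theorem norm_tailIoi49_le (hD : 3 ≤ D) (hχ : χ.IsPrimitive) (hL : 100 ≤ ell D)
    {C : ℝ} (hC1 : 1 ≤ C) (hC : ∀ n : ℕ, n ≠ 0 → ((n.divisors.card : ℕ) : ℝ) ≤ C * (n : ℝ) ^ (1 / 4 : ℝ))
    {s : ℂ} (hs : s ∈ Omega3 D) (hα : alpha D ≤ 1 / 4) :
    ‖∫ v in Ioi (ell D ^ 20), perronIntegrand D (f49 χ x s) (((-s.re - 1 / 2 : ℝ) : ℂ) + v * I)‖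
      ≤ 8 * Real.exp 1 * C * (∑' n : ℕ, (n : ℝ) ^ (-(5 / 4 : ℝ))) * Real.exp (-(ell D ^ 9)) := by
  have hL1 : 1 ≤ ell D := by linarith
  set S : ℝ := ∑' n : ℕ, (n : ℝ) ^ (-(5 / 4 : ℝ)) with hSdef
  have hS0 : 0 ≤ S := tsum_nonneg fun n => by positivity
  set V : ℝ := ell D ^ 20 with hV_def
  have hV0 : 0 ≤ V := by positivity
  obtain ⟨-, habs⟩ := im_bounds_of_mem_Omega3 (by linarith) hs
  set K3 : ℝ := 8 * Real.exp 1 * C * S * (D : ℝ) * bigP D ^ 2 with hK3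
  have hK30 : 0 ≤ K3 := by positivity
  set G : ℝ → ℝ := fun v => K3 * (((3 / 2 + |s.im|) ^ 2 + v ^ 2) *
    Real.exp (-(v ^ 2) / (4 * ell D ^ 30))) with hG_def
  have hGint : Integrable G :=
    (integrable_sq_weight_gauss (by positivity : (0 : ℝ) < ell D ^ 30) _).const_mul K3
  have h1 : ‖∫ v in Ioi V, perronIntegrand D (f49 χ x s) (((-s.re - 1 / 2 : ℝ) : ℂ) + v * I)‖
      ≤ ∫ v in Ioi V, G v :=
    norm_integral_le_of_norm_le hGint.integrableOn
      (ae_restrict_of_forall_mem measurableSet_Ioi fun v hv =>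
        norm_f49_integrand_tail_le χ x hD hχ hL1 hC1 hC hs hα ((le_of_lt hv).trans (le_abs_self v)))
  have h2 : ∫ v in Ioi V, G v = K3 * ∫ v in Ioi V, ((3 / 2 + |s.im|) ^ 2 + v ^ 2) *
      Real.exp (-(v ^ 2) / (4 * ell D ^ 30)) := integral_const_mul _ _
  have h3 := integral_Ioi_sq_mul_gauss_le (by positivity : (0 : ℝ) < ell D ^ 30)
    (by positivity : (0 : ℝ) ≤ (3 / 2 + |s.im|) ^ 2) hV0
  have htail := tail_budget hD hL habs
  have hE : Real.exp (-10 * ell D ^ 9) ≤ Real.exp (-(ell D ^ 9)) :=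
    Real.exp_le_exp.mpr (by nlinarith [pow_nonneg (show (0 : ℝ) ≤ ell D by linarith) 9])
  calc ‖∫ v in Ioi V, perronIntegrand D (f49 χ x s) (((-s.re - 1 / 2 : ℝ) : ℂ) + v * I)‖
      ≤ K3 * ∫ v in Ioi V, ((3 / 2 + |s.im|) ^ 2 + v ^ 2) * Real.exp (-(v ^ 2) / (4 * ell D ^ 30)) := by
        rw [← h2]; exact h1
    _ ≤ K3 * (Real.exp (-(V ^ 2) / (8 * ell D ^ 30)) * ((3 / 2 + |s.im|) ^ 2 + 16 * ell D ^ 30) *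
        Real.sqrt (16 * π * ell D ^ 30)) := mul_le_mul_of_nonneg_left h3 hK30
    _ = 8 * Real.exp 1 * C * S * ((D : ℝ) * bigP D ^ 2 *
        (Real.exp (-(V ^ 2) / (8 * ell D ^ 30)) * ((3 / 2 + |s.im|) ^ 2 + 16 * ell D ^ 30) *
        Real.sqrt (16 * π * ell D ^ 30))) := by rw [hK3]; ring
    _ ≤ 8 * Real.exp 1 * C * S * Real.exp (-10 * ell D ^ 9) :=
        mul_le_mul_of_nonneg_left htail (by positivity)
    _ ≤ 8 * Real.exp 1 * C * S * Real.exp (-(ell D ^ 9)) :=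
        mul_le_mul_of_nonneg_left hE (by positivity)

/-- **Lower tail of the (4.9)-contour** (`v < −𝓛²⁰`): the mirror bound `≤ 8e·C_τS·e^{−𝓛⁹}`.
[cite: Zhang2022LandauSiegel, §4 (4.9) (proof)] -/
theorem norm_tailIic49_le (hD : 3 ≤ D) (hχ : χ.IsPrimitive) (hL : 100 ≤ ell D)
    {C : ℝ} (hC1 : 1 ≤ C) (hC : ∀ n : ℕ, n ≠ 0 → ((n.divisors.card : ℕ) : ℝ) ≤ C * (n : ℝ) ^ (1 / 4 : ℝ))
    {s : ℂ} (hs : s ∈ Omega3 D) (hα : alpha D ≤ 1 / 4) :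
    ‖∫ v in Iic (-(ell D ^ 20)), perronIntegrand D (f49 χ x s) (((-s.re - 1 / 2 : ℝ) : ℂ) + v * I)‖
      ≤ 8 * Real.exp 1 * C * (∑' n : ℕ, (n : ℝ) ^ (-(5 / 4 : ℝ))) * Real.exp (-(ell D ^ 9)) := by
  have hL1 : 1 ≤ ell D := by linarith
  set S : ℝ := ∑' n : ℕ, (n : ℝ) ^ (-(5 / 4 : ℝ)) with hSdef
  have hS0 : 0 ≤ S := tsum_nonneg fun n => by positivity
  set V : ℝ := ell D ^ 20 with hV_def
  have hV0 : 0 ≤ V := by positivity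
  obtain ⟨-, habs⟩ := im_bounds_of_mem_Omega3 (by linarith) hs
  set K3 : ℝ := 8 * Real.exp 1 * C * S * (D : ℝ) * bigP D ^ 2 with hK3
  have hK30 : 0 ≤ K3 := by positivity
  set G : ℝ → ℝ := fun v => K3 * (((3 / 2 + |s.im|) ^ 2 + v ^ 2) *
    Real.exp (-(v ^ 2) / (4 * ell D ^ 30))) with hG_def
  have hGint : Integrable G :=
    (integrable_sq_weight_gauss (by positivity : (0 : ℝ) < ell D ^ 30) _).const_mul K3
  have h1 : ‖∫ v in Iic (-V), perronIntegrand D (f49 χ x s) (((-s.re - 1 / 2 : ℝ) : ℂ) + v * I)‖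
      ≤ ∫ v in Iic (-V), G v :=
    norm_integral_le_of_norm_le hGint.integrableOn
      (ae_restrict_of_forall_mem measurableSet_Iic fun v hv =>
        norm_f49_integrand_tail_le χ x hD hχ hL1 hC1 hC hs hα (by
          have : v ≤ -V := hv
          rw [abs_of_nonpos (by linarith)]; linarith))
  have h2 : ∫ v in Iic (-V), G v = K3 * ∫ v in Iic (-V), ((3 / 2 + |s.im|) ^ 2 + v ^ 2) *
      Real.exp (-(v ^ 2) / (4 * ell D ^ 30)) := integral_const_mul _ _
  have h3 := integral_Iic_sq_mul_gauss_le (by positivity : (0 : ℝ) < ell D ^ 30)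
    (by positivity : (0 : ℝ) ≤ (3 / 2 + |s.im|) ^ 2) hV0
  have htail := tail_budget hD hL habs
  have hE : Real.exp (-10 * ell D ^ 9) ≤ Real.exp (-(ell D ^ 9)) :=
    Real.exp_le_exp.mpr (by nlinarith [pow_nonneg (show (0 : ℝ) ≤ ell D by linarith) 9])
  calc ‖∫ v in Iic (-V), perronIntegrand D (f49 χ x s) (((-s.re - 1 / 2 : ℝ) : ℂ) + v * I)‖
      ≤ K3 * ∫ v in Iic (-V), ((3 / 2 + |s.im|) ^ 2 + v ^ 2) * Real.exp (-(v ^ 2) / (4 * ell D ^ 30)) := by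
        rw [← h2]; exact h1
    _ ≤ K3 * (Real.exp (-(V ^ 2) / (8 * ell D ^ 30)) * ((3 / 2 + |s.im|) ^ 2 + 16 * ell D ^ 30) *
        Real.sqrt (16 * π * ell D ^ 30)) := mul_le_mul_of_nonneg_left h3 hK30
    _ = 8 * Real.exp 1 * C * S * ((D : ℝ) * bigP D ^ 2 *
        (Real.exp (-(V ^ 2) / (8 * ell D ^ 30)) * ((3 / 2 + |s.im|) ^ 2 + 16 * ell D ^ 30) *
        Real.sqrt (16 * π * ell D ^ 30))) := by rw [hK3]; ring
    _ ≤ 8 * Real.exp 1 * C * S * Real.exp (-10 * ell D ^ 9) :=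
        mul_le_mul_of_nonneg_left htail (by positivity)
    _ ≤ 8 * Real.exp 1 * C * S * Real.exp (-(ell D ^ 9)) :=
        mul_le_mul_of_nonneg_left hE (by positivity)

end Pieces

/-- **The shifted-contour bound of (4.9) HOLDS** (node `Section4.Contour49Bound`, DAG `Z22:(4.9)` /
`Z22:§4.u036–u037`, [Z22 pp.20–21, proof of Lemma 4.4, tex L1117–L1125]): with `c = 1` and an
absolute `C`, for all large `D`, every real primitive `χ (mod D)`, every `ψ ∈ Ψ`, every `s ∈ Ω₃`,
`‖perronContour D (f49 χ x s) (−σ−1/2) (−σ−10) 𝓛²⁰‖ ≤ C·P⁻¹`. Unconditional; proof = the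
manuscript's sentence made quantitative (Stirling at every height, Gaussian decay of `ω₁`, the divisor
bound for the tail sum). [cite: Zhang2022LandauSiegel, §4 (4.9)] -/
theorem contour49Bound_holds : Contour49Bound := by
  obtain ⟨Cτ, hC1, hC⟩ := Literature.NumberTheory.Sieve.exists_card_divisors_le_mul_rpow
    (show (0 : ℝ) < 1 / 4 by norm_num)
  set S : ℝ := ∑' n : ℕ, (n : ℝ) ^ (-(5 / 4 : ℝ)) with hSdef
  have hS0 : 0 ≤ S := tsum_nonneg fun n => by positivity
  refine ⟨1, one_pos, Cτ * S * (40 * Real.exp 36 + 16 * Real.exp 1), ⌈Real.exp 100⌉₊,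
    fun D _ χ hD _hq hp x s hs => ?_⟩
  have hexp : Real.exp 100 ≤ D := le_trans (Nat.le_ceil _) (by exact_mod_cast hD)
  have hD0 : (0 : ℝ) < D := lt_of_lt_of_le (Real.exp_pos 100) hexp
  have hL : 100 ≤ ell D := (Real.le_log_iff_exp_le hD0).mpr hexp
  have hL1 : 1 ≤ ell D := by linarith
  have hD3 : 3 ≤ D := by
    have h3 : (3 : ℝ) ≤ Real.exp 100 := by
      have := Real.add_one_le_exp (100 : ℝ); linarith
    exact_mod_cast h3.trans hexp
  have hα : alpha D ≤ 1 / 4 := by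
    have h9 : (100 : ℝ) ≤ ell D ^ 9 := le_trans hL (le_self_pow₀ hL1 (by norm_num))
    have hlogP : Real.log (bigP D) = ell D ^ 9 := by rw [bigP, Real.log_exp]
    rw [alpha, hlogP, div_le_iff₀ (by linarith)]
    nlinarith [Real.pi_lt_four]
  have hP : bigP D ^ (-(1 : ℝ)) = Real.exp (-(ell D ^ 9)) := by
    rw [bigP, ← Real.exp_mul]; ring_nf
  rw [hP]
  -- the five pieces
  have hM := norm_middle49_le χ x hD3 hp hL hC1 hC hs hα
  have hHup := norm_horiz49_le χ x hD3 hp hL hC1 hC hs hα (W := ell D ^ 20) (Or.inl rfl)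
  have hHlow' := norm_horiz49_le χ x hD3 hp hL hC1 hC hs hα (W := -(ell D ^ 20)) (Or.inr rfl)
  have hT2 := norm_tailIoi49_le χ x hD3 hp hL hC1 hC hs hα
  have hT1 := norm_tailIic49_le χ x hD3 hp hL hC1 hC hs hα
  -- the lower horizontal is written with `u − V·I`
  have hHlow : ‖∫ u in (-s.re - 1 / 2)..(-s.re - 10),
      perronIntegrand D (f49 χ x s) ((u : ℂ) - ((ell D ^ 20 : ℝ) : ℂ) * I)‖
      ≤ 19 * Cτ * S * Real.exp 36 * Real.exp (-(ell D ^ 9)) := by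
    have e : (fun u : ℝ => perronIntegrand D (f49 χ x s) ((u : ℂ) - ((ell D ^ 20 : ℝ) : ℂ) * I))
        = fun u : ℝ => perronIntegrand D (f49 χ x s) ((u : ℂ) + ((-(ell D ^ 20) : ℝ) : ℂ) * I) := by
      funext u; congr 1; push_cast; ring
    rw [e]; exact hHlow'
  -- norms of the two prefactors are `≤ 1`
  have hn1 : ‖(1 / (2 * π) : ℂ)‖ ≤ 1 := by
    have e : (1 / (2 * π) : ℂ) = ((1 / (2 * π) : ℝ) : ℂ) := by push_cast; ring
    rw [e, Complex.norm_real, Real.norm_of_nonneg (by positivity)]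
    rw [div_le_one (by positivity)]; linarith [Real.pi_gt_three]
  have h2π : ‖(2 * π : ℂ)‖ = 2 * π := by
    have e : (2 * π : ℂ) = ((2 * π : ℝ) : ℂ) := by push_cast; ring
    rw [e, Complex.norm_real, Real.norm_of_nonneg (by positivity)]
  have hn2 : ‖(1 / (2 * π * I) : ℂ)‖ ≤ 1 := by
    rw [norm_div, norm_one, norm_mul, Complex.norm_I, mul_one, h2π]
    rw [div_le_one (by positivity)]; linarith [Real.pi_gt_three]
  rw [perronContour]
  have hE0 : 0 ≤ Real.exp (-(ell D ^ 9)) := (Real.exp_pos _).le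
  calc ‖(1 / (2 * π) : ℂ) * ((∫ v in Iic (-(ell D ^ 20)),
            perronIntegrand D (f49 χ x s) (((-s.re - 1 / 2 : ℝ) : ℂ) + v * I))
          + (∫ v in (-(ell D ^ 20))..(ell D ^ 20),
            perronIntegrand D (f49 χ x s) (((-s.re - 10 : ℝ) : ℂ) + v * I))
          + ∫ v in Ioi (ell D ^ 20),
            perronIntegrand D (f49 χ x s) (((-s.re - 1 / 2 : ℝ) : ℂ) + v * I))
        + (1 / (2 * π * I) : ℂ) * ((∫ u in (-s.re - 1 / 2)..(-s.re - 10),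
            perronIntegrand D (f49 χ x s) ((u : ℂ) - ((ell D ^ 20 : ℝ) : ℂ) * I))
          - ∫ u in (-s.re - 1 / 2)..(-s.re - 10),
            perronIntegrand D (f49 χ x s) ((u : ℂ) + ((ell D ^ 20 : ℝ) : ℂ) * I))‖
      ≤ ‖(1 / (2 * π) : ℂ)‖ * (‖∫ v in Iic (-(ell D ^ 20)),
            perronIntegrand D (f49 χ x s) (((-s.re - 1 / 2 : ℝ) : ℂ) + v * I)‖
          + ‖∫ v in (-(ell D ^ 20))..(ell D ^ 20),
            perronIntegrand D (f49 χ x s) (((-s.re - 10 : ℝ) : ℂ) + v * I)‖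
          + ‖∫ v in Ioi (ell D ^ 20),
            perronIntegrand D (f49 χ x s) (((-s.re - 1 / 2 : ℝ) : ℂ) + v * I)‖)
        + ‖(1 / (2 * π * I) : ℂ)‖ * (‖∫ u in (-s.re - 1 / 2)..(-s.re - 10),
            perronIntegrand D (f49 χ x s) ((u : ℂ) - ((ell D ^ 20 : ℝ) : ℂ) * I)‖
          + ‖∫ u in (-s.re - 1 / 2)..(-s.re - 10),
            perronIntegrand D (f49 χ x s) ((u : ℂ) + ((ell D ^ 20 : ℝ) : ℂ) * I)‖) := by
        refine (norm_add_le _ _).trans (add_le_add ?_ ?_)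
        · rw [norm_mul]
          exact mul_le_mul_of_nonneg_left ((norm_add_le _ _).trans
            (add_le_add (norm_add_le _ _) le_rfl)) (norm_nonneg _)
        · rw [norm_mul]
          exact mul_le_mul_of_nonneg_left (norm_sub_le _ _) (norm_nonneg _)
    _ ≤ 1 * (8 * Real.exp 1 * Cτ * S * Real.exp (-(ell D ^ 9))
          + 2 * Cτ * S * Real.exp 36 * Real.exp (-(ell D ^ 9))
          + 8 * Real.exp 1 * Cτ * S * Real.exp (-(ell D ^ 9)))
        + 1 * (19 * Cτ * S * Real.exp 36 * Real.exp (-(ell D ^ 9))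
          + 19 * Cτ * S * Real.exp 36 * Real.exp (-(ell D ^ 9))) := by
        gcongr
    _ = Cτ * S * (40 * Real.exp 36 + 16 * Real.exp 1) * Real.exp (-(ell D ^ 9)) := by ring

/-- **`Ded49 : Eq45 → Contour49Bound` HOLDS** (node `Section4.Ded49`, DAG `Z22:(4.9)` deduction,
[Z22 p.21]) — by `contour49Bound_holds`, without using its hypothesis.
[cite: Zhang2022LandauSiegel, §4 (4.9)] -/
theorem ded49_holds : Ded49 := fun _ => contour49Bound_holds

/-- `Ded49` — `_holds` alias of `ded49_holds` above under the fact's exact name (appended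
2026-08-28, D-0026 bookkeeping: the proof term is the existing theorem of this file; no statement,
definition or attribute is edited; no new named fact; the ledger's debt table listed the fact
unproved). [cite: Zhang2022LandauSiegel, §4 (4.9)] -/
theorem _root_.Literature.NumberTheory.LFunctions.Zhang2022.Section4.Ded49_holds : Ded49 :=
  _root_.Literature.NumberTheory.LFunctions.Zhang2022.Section4.ded49_holds

/-- **(4.9) HOLDS** (node `Section4.Eq49`): the typed composition `eq49_of` of d04's contour shift
`shift49_holds` with `contour49Bound_holds`. [cite: Zhang2022LandauSiegel, §4 (4.9)] -/
theorem eq49_holds : Eq49 := eq49_of shift49_holds contour49Bound_holds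

/-- `Eq49` — `_holds` alias of `eq49_holds` above under the fact's exact name (appended
2026-08-28, D-0026 bookkeeping: the proof term is the existing theorem of this file; no statement,
definition or attribute is edited; no new named fact; the ledger's debt table listed the fact
unproved). [cite: Zhang2022LandauSiegel, §4 (4.9)] -/
theorem _root_.Literature.NumberTheory.LFunctions.Zhang2022.Section4.Eq49_holds : Eq49 :=
  _root_.Literature.NumberTheory.LFunctions.Zhang2022.Section4.eq49_holds

end Literature.NumberTheory.LFunctions.Zhang2022.Section4
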